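import Literature.NumberTheory.EllipticCurves.ZpExtensionEisensteinTwistFixedPointTorsionProofs
import Literature.NumberTheory.EllipticCurves.ZpExtensionEisensteinTwistLocalH1BoundProofs
import Literature.NumberTheory.EllipticCurves.ZpExtensionEisensteinSelmerStructureProofs
import Literature.NumberTheory.GaloisCohomology.Howard2004.SelmerTriples
import HarnessLib

/-!
# Uniform `p`-torsion of the local invariants of Howard's Eisenstein levels, of their ordinary sub-twists and of
# their quotients at the places above `p` (theorems only)

`Proofs` file (theorems only; no definition, no named fact, no instance, no `sorry`).  Topic `NumberTheory/EllipticCurves`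
(cell `pub/bsd-print-x9`, D1 road; brick (B4) of the memo `HOME/p1/H4-EXACT-AT-P-PLAN-x10b-p1-g8.md`: the torsion-exponent
input of the limit right-kernel argument `Tower.pow_smul_eq_zero_of_forall_pairing_eq_zero` for Howard's hypothesis H.4 on
`F_𝔮` at `v ∣ p`).  Companion of x9-p1-w3's `ZpExtensionEisensteinTwistFixedPointTorsionProofs` (the Cayley–Hamilton
annihilator `Δ = 1 + a₁(1+T)^{p^s} + a₀(1+T)^{2p^s}` of the fixed vectors of an element `σ₀` with `κ(σ₀) = p^s` is
`[T]^a · unit` with `a ≤ 2p^s` in `A_{m,j} = Λ/(T^m + p, p^j)` when `m > 2p^s`), whose conclusion `[T]^{m-1} • w = 0` is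
here SHARPENED and taken MODULO a stable submodule:

* §1 (pure algebra in `A_{m,k}`) `p = −[T]^m` as a natural-number cast; passing from `([T]^a ε) • x ∈ N` to
  `[T]^a • x ∈ N`, raising the exponent, and from `[T]^a • x ∈ N` (`a ≤ m`) to `(p : ℤ) • x ∈ N`, for any additive
  subgroup `N` of an `A_{m,k}`-module stable under the scalars.
* §2 **`ZpExtension.mk_X_pow_two_mul_smul_mem_of_eisensteinTwist_apply_sub_mem`** — for `W_{m,j} = E[p^j] ⊗ A_{m,j}(ψ)`
  (`κ.eisensteinTwist (torsionGaloisModule (p^j)) hm j`), `σ₀ ∈ Γ_K` with `κ(σ₀) = p^s`, `2p^s < m`, and ANY additive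
  subgroup `N ≤ W_{m,j}` stable under `A_{m,j}` and under `σ₀`: every `x` fixed by `σ₀` MODULO `N` (`σ₀ x − x ∈ N`) has
  **`[T]^{2p^s} • x ∈ N`, hence `(p : ℤ) • x ∈ N` and `[T]^{m-1} • x ∈ N`** — for EVERY `j` (Cayley–Hamilton on `T_p E`:
  `Δ • x = −(f + σ₀ f + a₁(1+T)^{p^s} f) ∈ N`, `f = σ₀ x − x`).  With `N = 0`: the `σ₀`-fixed vectors are killed by
  `[T]^{2p^s}` and by `p` (`…_smul_eq_zero_of_apply_eq_self`).
* §3 LOCAL forms at a finite place `w` with some `g₀ ∈ Γ_{K_w}`, `κ(g₀) = p^s`, `2p^s < m`: the `Γ_{K_w}`-invariants of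
  `W_{m,j}` are killed by `p` (`natCast_smul_eq_zero_of_toLocal_apply_eq_self`); for an ordinary datum `Φ` at `w`
  (`ZpExtension.OrdinaryFiltration`, intended `Fil_w E[p^j] = Ê[p^j]` at `w ∣ p`) the invariants of `W_{m,j}` MODULO the
  twisted plus part `Fil_w W_{m,j} = A_{m,j} ⊗ Fil_w E[p^j]` (`Φ.twistedFil j`) are killed by `p` into `Fil_w W_{m,j}`
  (`OrdinaryFiltration.natCast_smul_mem_twistedFil_of_forall_toLocal_sub_mem`), i.e. **`p · H⁰(K_w, W_{m,j}/Fil_w W_{m,j}) = 0`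
  on the quotient module** (`OrdinaryFiltration.natCast_smul_eq_zero_of_forall_quotient_apply_eq_self`, the tree's
  `ContinuousRep.quotient` by `twistedFil`, the module whose `H¹` defines `ordinaryCore`), and **`p · H⁰(K_w, Fil_w W_{m,j}) = 0`**;
  the same through Howard's conjugation twist `Tw` (`ConjugationDatum.twist`: `g ↦ ρ(τ⁻¹ g τ)`), where for an
  anticyclotomic `κ` the element to use is `τ⁻¹ g₀⁻¹ τ` (`toAdd_apply_conj_absGaloisRestrict_inv_eq_of_anticyclotomic`).
* §4 the element `g₀`: at a place whose decomposition group is not inside `ker κ` (true above `p` in the anticyclotomic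
  tower, tree `decomp_not_le_kerSubgroup_above_of_isAnticyclotomic_anyPrime`) some `g₀ ∈ Γ_{K_w}` has `κ(g₀) = p^s`
  exactly (`exists_toAdd_apply_absGaloisRestrict_eq_pow_of_not_decomp_le`), and the packaged statement
  **`exists_forall_natCast_smul_invariants_of_not_decomp_le`**: `∃ m₀, ∀ m > m₀, ∀ j`, the three `p`-torsion statements
  (module, sub, quotient) at `w` — exponent `c_w = 1`, UNIFORM in `j` and in `m`.

Why this is the right input for H.4 at `v ∣ p` (memo §1(d)): the torsion compatible families of the local tower
`(H¹(K_v, gr W_{m,j}))_j` are connecting images of `⋃_d H⁰(K_v, gr W_{m,d})`, so a uniform exponent for these `H⁰` is a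
uniform exponent for the torsion of `lim_j H¹(K_v, gr W_{m,j})`.  No reduction type enters §2 (any `E`, any `σ₀` with
`κ(σ₀) = p^s`); at `w ∣ p` the character bookkeeping «`(αψ)(g₀) − 1 = [T]^{p^s} · unit`» of the memo is subsumed by
Cayley–Hamilton.  No summit statement is proved; BSD is not proved by any of this.  Seat `bsd-line-x10b-p1-w5` g2.

References: [Howard2004HeegnerKolyvagin] B. Howard, *The Heegner point Kolyvagin system*, Compositio Math. 140 (2004),
§1.3 H.4, §2.2 (proof of Thm. 2.2.10: `𝔮 = T^m + p`), §3.1 (`Fil_v`, `H¹_ord`), Def. 3.2.6; [GreenbergLNM1716] R. Greenberg,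
LNM 1716 (1999), §2 and proof of Prop. 4.15 (finiteness of twisted local invariants); [MilneADT2006] J. S. Milne,
*Arithmetic Duality Theorems*, I Cor. 2.3 (local duality for finitely generated modules via finite levels);
[SilvermanAEC2009] III.7.1, VII.2; [Washington1997] §7.1, §13.2.
-/

set_option autoImplicit false

noncomputable section

open Polynomial Field
open scoped ContRepresentation

universe u v

namespace Literature.NumberTheory.EllipticCurves

/-! ## §1 Pure algebra in `A_{m,k}`: from `Δ • x ∈ N` to `(p : ℤ) • x ∈ N` -/

namespace IwasawaAlgebra

namespace EisensteinCoeff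

variable (p : ℕ) [hp : Fact p.Prime]

/-- `(p : A_{m,k}) = −[T]^m` (the natural-number cast; `𝔮 = T^m + p ↦ 0`).
[cite: Howard2004HeegnerKolyvagin, proof of Thm. 2.2.10 (𝔮 = T^m + p)] [cite: Washington1997, §13.2] -/
theorem natCast_eq_neg_mk_X_pow (m k : ℕ) :
    ((p : ℕ) : EisensteinCoeff p m k) = -(Ideal.Quotient.mk _ PowerSeries.X) ^ m := by
  rw [← map_natCast (algebraMap ℤ_[p] (EisensteinCoeff p m k)) p, algebraMap_padicInt_eq_mk_C, mk_C_eq_neg_mk_X_pow]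

variable {p} {m k : ℕ} {V : Type v} [AddCommGroup V] [Module (EisensteinCoeff p m k) V] {N : AddSubgroup V}

/-- If `N` is stable under the scalars of `A_{m,k}` and `([T]^a · ε) • x ∈ N` with `ε` a unit, then `[T]^a • x ∈ N`.
[cite: Washington1997, §7.1 (units of a local ring)] -/
theorem mk_X_pow_smul_mem_of_mul_unit_smul_mem (hN : ∀ (c : EisensteinCoeff p m k) (x : V), x ∈ N → c • x ∈ N)
    {a : ℕ} {ε : EisensteinCoeff p m k} (hε : IsUnit ε) {x : V}
    (hx : ((Ideal.Quotient.mk _ PowerSeries.X) ^ a * ε) • x ∈ N) :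
    (Ideal.Quotient.mk _ PowerSeries.X : EisensteinCoeff p m k) ^ a • x ∈ N := by
  obtain ⟨w, rfl⟩ := hε
  have h := hN ((w⁻¹ : (EisensteinCoeff p m k)ˣ) : EisensteinCoeff p m k) _ hx
  rwa [smul_smul, mul_comm ((Ideal.Quotient.mk _ PowerSeries.X) ^ a) (w : EisensteinCoeff p m k), ← mul_assoc,
    Units.inv_mul, one_mul] at h

/-- Raising the exponent: `[T]^a • x ∈ N`, `a ≤ b` ⇒ `[T]^b • x ∈ N` (for `N` stable under the scalars).
[cite: Washington1997, §7.1] -/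
theorem mk_X_pow_smul_mem_of_le (hN : ∀ (c : EisensteinCoeff p m k) (x : V), x ∈ N → c • x ∈ N) {a b : ℕ}
    (hab : a ≤ b) {x : V} (hx : (Ideal.Quotient.mk _ PowerSeries.X : EisensteinCoeff p m k) ^ a • x ∈ N) :
    (Ideal.Quotient.mk _ PowerSeries.X : EisensteinCoeff p m k) ^ b • x ∈ N := by
  obtain ⟨d, rfl⟩ := Nat.exists_eq_add_of_le' hab
  rw [pow_add, mul_smul]
  exact hN _ _ hx

/-- **From `[T]^a • x ∈ N` (`a ≤ m`) to `(p : ℤ) • x ∈ N`**: `p = −[T]^m` in `A_{m,k}`.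
[cite: Howard2004HeegnerKolyvagin, proof of Thm. 2.2.10 (𝔮 = T^m + p)] [cite: Washington1997, §13.2] -/
theorem natCast_smul_mem_of_mk_X_pow_smul_mem (hN : ∀ (c : EisensteinCoeff p m k) (x : V), x ∈ N → c • x ∈ N)
    {a : ℕ} (ham : a ≤ m) {x : V} (hx : (Ideal.Quotient.mk _ PowerSeries.X : EisensteinCoeff p m k) ^ a • x ∈ N) :
    (p : ℤ) • x ∈ N := by
  have hm' := mk_X_pow_smul_mem_of_le hN ham hx
  rw [← Int.cast_smul_eq_zsmul (EisensteinCoeff p m k) (p : ℤ) x, Int.cast_natCast, natCast_eq_neg_mk_X_pow p m k,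
    neg_smul]
  exact N.neg_mem hm'

end EisensteinCoeff

end IwasawaAlgebra

/-! ## §2 Cayley–Hamilton modulo a stable submodule: `[T]^{2p^s}` and `p` kill the `σ₀`-invariants of `W_{m,j}/N` -/

namespace ZpExtension

open IwasawaAlgebra IwasawaAlgebra.EisensteinCoeff Literature.NumberTheory.GaloisRepresentations
  Literature.Algebra.Module

variable {K : Type u} [Field K] (W : WeierstrassCurve K) [W.IsElliptic] {p : ℕ} [hp : Fact p.Prime]
  (κ : ZpExtension K p) {m : ℕ} (hm : 1 ≤ m)

set_option maxHeartbeats 400000 in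
/-- **`[T]^{2p^s}` kills the `σ₀`-invariants of `W_{m,j}` modulo any stable submodule.**  Let `κ(σ₀) = p^s`, `2p^s < m`,
and let `N ≤ W_{m,j} = E[p^j] ⊗ A_{m,j}(ψ)` be an additive subgroup stable under `A_{m,j}` and under `σ₀`.  If `σ₀ x − x ∈ N`
then `[T]^{2p^s} • x ∈ N`: by Cayley–Hamilton on `T_p E` the homogenised characteristic polynomial of `σ₀` kills
`φ = (1+T)^{p^s} ⊗ ρ_j(σ₀)`, so `Δ • x = −(f + φ f + a₁(1+T)^{p^s} f) ∈ N` with `f = φ x − x` and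
`Δ = 1 + a₁(1+T)^{p^s} + a₀(1+T)^{2p^s} = [T]^a · ε`, `a ≤ 2p^s`, `ε` a unit (x9-p1-w3's exponent form).
[cite: Howard2004HeegnerKolyvagin, §1.3 H.4 and §2.2, proof of Thm. 2.2.10] [cite: GreenbergLNM1716, proof of Prop. 4.15]
[cite: SilvermanAEC2009, Prop. III.7.1] -/
theorem mk_X_pow_two_mul_smul_mem_of_eisensteinTwist_apply_sub_mem (hpK : (p : K) ≠ 0)
    {σ₀ : absoluteGaloisGroup K} {s : ℕ} (hσ : (κ σ₀).toAdd = ((p ^ s : ℕ) : ℤ_[p])) (hms : 2 * p ^ s < m) (j : ℕ)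
    (N : AddSubgroup (Twisted p m j (W.geomTorsion ((p : ℤ) ^ j))))
    (hNA : ∀ (c : EisensteinCoeff p m j) (x : Twisted p m j (W.geomTorsion ((p : ℤ) ^ j))), x ∈ N → c • x ∈ N)
    (hNσ : ∀ x ∈ N, κ.eisensteinTwist (W.torsionGaloisModule ((p : ℤ) ^ j)) hm j σ₀ x ∈ N)
    (x : Twisted p m j (W.geomTorsion ((p : ℤ) ^ j)))
    (hx : κ.eisensteinTwist (W.torsionGaloisModule ((p : ℤ) ^ j)) hm j σ₀ x - x ∈ N) :
    ((Ideal.Quotient.mk _ PowerSeries.X : EisensteinCoeff p m j) ^ (2 * p ^ s)) • x ∈ N := by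
  obtain ⟨a₁, a₀, ha₀, hCH⟩ := W.exists_cayleyHamilton_torsion p hpK σ₀
  -- abbreviations (as in `mk_X_pow_pred_smul_eq_zero_of_apply_eq_self`)
  set A := EisensteinCoeff p m j with hA
  set M := ↥(W.geomTorsion ((p : ℤ) ^ j)) with hM
  set ρ := W.torsionGaloisModule ((p : ℤ) ^ j) with hρ
  set u : A := onePlusT p m j ^ (p ^ s) with hu
  have hcast : ∀ a : ℤ_[p], algebraMap ℤ_[p] A a = ((PadicInt.toZModPow j a).val : A) := fun a ↦ by
    rw [EisensteinCoeff.algebraMap_padicInt_eq_ofZMod_toZModPow p hm j, EisensteinCoeff.ofZMod_apply]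
  -- the twisted action of `σ₀` as an `A`-linear endomorphism
  let φ : Module.End A (Twisted p m j M) :=
    { toFun := fun w ↦ κ.eisensteinTwist ρ hm j σ₀ w
      map_add' := fun x y ↦ map_add _ x y
      map_smul' := fun c x ↦ κ.eisensteinTwist_apply_smul ρ hm j σ₀ c x }
  have hφ : ∀ w, φ w = κ.eisensteinTwist ρ hm j σ₀ w := fun _ ↦ rfl
  have hφt : ∀ (c : A) (a : M), φ (Twisted.tmul c a) = Twisted.tmul (u * c) (σ₀ • a) := fun c a ↦ by
    rw [hφ, eisensteinTwist_apply_tmul, κ.onePlusT_pow_twistExponent_eq_of_toAdd_eq_natCast hm j hσ, hρ,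
      WeierstrassCurve.torsionGaloisModule_apply_apply]
  -- Cayley–Hamilton at level `j`, inside `E[p^j]`
  have hCHj : ∀ a : M, σ₀ • σ₀ • a + (PadicInt.toZModPow j a₁).val • σ₀ • a + (PadicInt.toZModPow j a₀).val • a = 0 :=
    fun a ↦ by
    have ha : ((p : ℤ) ^ j) • (a : W.geomPoints) = 0 := (Submodule.mem_torsionBy_iff _ _).1 a.2
    have h := hCH j (a : W.geomPoints) ha
    apply Subtype.ext
    rw [natCast_zsmul, natCast_zsmul] at h
    have e : ((σ₀ • σ₀ • a + (PadicInt.toZModPow j a₁).val • σ₀ • a + (PadicInt.toZModPow j a₀).val • a : M) :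
        W.geomPoints) = σ₀ • σ₀ • (a : W.geomPoints) + (PadicInt.toZModPow j a₁).val • σ₀ • (a : W.geomPoints) +
          (PadicInt.toZModPow j a₀).val • (a : W.geomPoints) := rfl
    rw [e, h]
    rfl
  -- the homogenised characteristic polynomial kills `φ`
  set b₁ : A := algebraMap ℤ_[p] A a₁ * u with hb₁
  set b₀ : A := algebraMap ℤ_[p] A a₀ * u ^ 2 with hb₀
  set P : A[X] := X ^ 2 + C b₁ * X + C b₀ with hPdef
  have hP : aeval φ P = 0 := by
    refine LinearMap.ext fun w ↦ ?_
    induction w using Twisted.induction_on with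
    | zero => rw [map_zero, LinearMap.zero_apply]
    | add x y hx hy => rw [map_add, hx, hy, LinearMap.zero_apply, LinearMap.zero_apply, LinearMap.zero_apply, add_zero]
    | tmul c a =>
      rw [LinearMap.zero_apply, hPdef]
      simp only [map_add, map_mul, aeval_X, aeval_C, LinearMap.add_apply, Module.End.mul_apply,
        Module.algebraMap_end_apply, pow_two]
      have e1 : b₁ * (u * c) = ((PadicInt.toZModPow j a₁).val : A) * (u * (u * c)) := by rw [hb₁, hcast]; ring
      have e2 : b₀ * c = ((PadicInt.toZModPow j a₀).val : A) * (u * (u * c)) := by rw [hb₀, hcast]; ring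
      rw [hφt, hφt, Twisted.smul_tmul, Twisted.smul_tmul, e1, e2, ← nsmul_eq_mul, ← nsmul_eq_mul,
        Twisted.nsmul_tmul, Twisted.nsmul_tmul, ← Twisted.tmul_add, ← Twisted.tmul_add, hCHj, Twisted.tmul_zero]
  -- `P(φ) x = 0`, read modulo `N`: `Δ • x = -(f + φ f + b₁ • f)` with `f = φ x - x ∈ N`
  have h0 : φ (φ x) + b₁ • φ x + b₀ • x = 0 := by
    have h := LinearMap.congr_fun hP x
    simpa only [hPdef, map_add, map_mul, aeval_X, aeval_C, LinearMap.add_apply, Module.End.mul_apply,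
      Module.algebraMap_end_apply, pow_two, LinearMap.zero_apply] using h
  set f := φ x - x with hfdef
  have hfN : f ∈ N := hx
  have hfx : φ x = x + f := by rw [hfdef, add_sub_cancel]
  rw [hfx, map_add, hfx, smul_add] at h0
  -- `h0 : x + f + (x + f + φ f) ... ` rearranged
  have h1 : (1 + b₁ + b₀) • x = -(f + φ f + b₁ • f) := by
    rw [add_smul, add_smul, one_smul]
    refine eq_neg_of_add_eq_zero_left ?_
    rw [← h0]
    abel
  have hΔN : (1 + algebraMap ℤ_[p] A a₁ * u + algebraMap ℤ_[p] A a₀ * u ^ 2) • x ∈ N := by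
    rw [← hb₁, ← hb₀, h1]
    exact N.neg_mem (N.add_mem (N.add_mem hfN (hNσ f hfN)) (hNA b₁ f hfN))
  -- `Δ = [T]^a · ε`, `a ≤ 2p^s`, `ε` a unit
  obtain ⟨a, ε, ha, hε, hΔ⟩ := EisensteinCoeff.exists_charTwistElement_eq_mk_X_pow_mul p j s a₁ a₀ ha₀ hms
  rw [hu, hΔ] at hΔN
  exact EisensteinCoeff.mk_X_pow_smul_mem_of_le hNA ha (EisensteinCoeff.mk_X_pow_smul_mem_of_mul_unit_smul_mem hNA hε hΔN)

/-- **Hence `(p : ℤ) • x ∈ N`** for every `x` fixed by `σ₀` modulo the stable subgroup `N` (`κ(σ₀) = p^s`, `2p^s < m`;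
`p = −[T]^m`): the `σ₀`-invariants of `W_{m,j}/N` are `p`-torsion, for every `j`.
[cite: Howard2004HeegnerKolyvagin, §1.3 H.4 and §2.2, proof of Thm. 2.2.10] [cite: GreenbergLNM1716, proof of Prop. 4.15] -/
theorem natCast_smul_mem_of_eisensteinTwist_apply_sub_mem (hpK : (p : K) ≠ 0)
    {σ₀ : absoluteGaloisGroup K} {s : ℕ} (hσ : (κ σ₀).toAdd = ((p ^ s : ℕ) : ℤ_[p])) (hms : 2 * p ^ s < m) (j : ℕ)
    (N : AddSubgroup (Twisted p m j (W.geomTorsion ((p : ℤ) ^ j))))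
    (hNA : ∀ (c : EisensteinCoeff p m j) (x : Twisted p m j (W.geomTorsion ((p : ℤ) ^ j))), x ∈ N → c • x ∈ N)
    (hNσ : ∀ x ∈ N, κ.eisensteinTwist (W.torsionGaloisModule ((p : ℤ) ^ j)) hm j σ₀ x ∈ N)
    (x : Twisted p m j (W.geomTorsion ((p : ℤ) ^ j)))
    (hx : κ.eisensteinTwist (W.torsionGaloisModule ((p : ℤ) ^ j)) hm j σ₀ x - x ∈ N) :
    (p : ℤ) • x ∈ N :=
  EisensteinCoeff.natCast_smul_mem_of_mk_X_pow_smul_mem hNA hms.le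
    (κ.mk_X_pow_two_mul_smul_mem_of_eisensteinTwist_apply_sub_mem W hm hpK hσ hms j N hNA hNσ x hx)

/-- And `[T]^{m-1} • x ∈ N` (the modulo-`N` form of x9-p1-w3's `mk_X_pow_pred_smul_eq_zero_of_apply_eq_self`).
[cite: Howard2004HeegnerKolyvagin, §1.3 H.5(b) and §2.2, proof of Thm. 2.2.10] -/
theorem mk_X_pow_pred_smul_mem_of_eisensteinTwist_apply_sub_mem (hpK : (p : K) ≠ 0)
    {σ₀ : absoluteGaloisGroup K} {s : ℕ} (hσ : (κ σ₀).toAdd = ((p ^ s : ℕ) : ℤ_[p])) (hms : 2 * p ^ s < m) (j : ℕ)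
    (N : AddSubgroup (Twisted p m j (W.geomTorsion ((p : ℤ) ^ j))))
    (hNA : ∀ (c : EisensteinCoeff p m j) (x : Twisted p m j (W.geomTorsion ((p : ℤ) ^ j))), x ∈ N → c • x ∈ N)
    (hNσ : ∀ x ∈ N, κ.eisensteinTwist (W.torsionGaloisModule ((p : ℤ) ^ j)) hm j σ₀ x ∈ N)
    (x : Twisted p m j (W.geomTorsion ((p : ℤ) ^ j)))
    (hx : κ.eisensteinTwist (W.torsionGaloisModule ((p : ℤ) ^ j)) hm j σ₀ x - x ∈ N) :
    ((Ideal.Quotient.mk _ PowerSeries.X : EisensteinCoeff p m j) ^ (m - 1)) • x ∈ N :=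
  EisensteinCoeff.mk_X_pow_smul_mem_of_le hNA (by omega)
    (κ.mk_X_pow_two_mul_smul_mem_of_eisensteinTwist_apply_sub_mem W hm hpK hσ hms j N hNA hNσ x hx)

/-- **`[T]^{2p^s}` kills the `σ₀`-fixed vectors of `W_{m,j}`** (`κ(σ₀) = p^s`, `2p^s < m`), for every `j` — the case
`N = 0`, sharpening `mk_X_pow_pred_smul_eq_zero_of_apply_eq_self`. [cite: Howard2004HeegnerKolyvagin, §2.2, proof of Thm. 2.2.10]
[cite: GreenbergLNM1716, proof of Prop. 4.15] -/
theorem mk_X_pow_two_mul_smul_eq_zero_of_apply_eq_self (hpK : (p : K) ≠ 0) {σ₀ : absoluteGaloisGroup K} {s : ℕ}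
    (hσ : (κ σ₀).toAdd = ((p ^ s : ℕ) : ℤ_[p])) (hms : 2 * p ^ s < m) (j : ℕ)
    (w : Twisted p m j (W.geomTorsion ((p : ℤ) ^ j)))
    (hw : κ.eisensteinTwist (W.torsionGaloisModule ((p : ℤ) ^ j)) hm j σ₀ w = w) :
    ((Ideal.Quotient.mk _ PowerSeries.X : EisensteinCoeff p m j) ^ (2 * p ^ s)) • w = 0 := by
  have h := κ.mk_X_pow_two_mul_smul_mem_of_eisensteinTwist_apply_sub_mem W hm hpK hσ hms j ⊥
    (fun c x hx ↦ by rw [AddSubgroup.mem_bot] at hx ⊢; rw [hx, smul_zero])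
    (fun x hx ↦ by rw [AddSubgroup.mem_bot] at hx ⊢; rw [hx, map_zero]) w
    (by rw [AddSubgroup.mem_bot, hw, sub_self])
  exact AddSubgroup.mem_bot.1 h

/-- **`p` kills the `σ₀`-fixed vectors of `W_{m,j}`** (`κ(σ₀) = p^s`, `2p^s < m`), for every `j`.
[cite: Howard2004HeegnerKolyvagin, §2.2, proof of Thm. 2.2.10] [cite: GreenbergLNM1716, proof of Prop. 4.15] -/
theorem natCast_smul_eq_zero_of_apply_eq_self (hpK : (p : K) ≠ 0) {σ₀ : absoluteGaloisGroup K} {s : ℕ}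
    (hσ : (κ σ₀).toAdd = ((p ^ s : ℕ) : ℤ_[p])) (hms : 2 * p ^ s < m) (j : ℕ)
    (w : Twisted p m j (W.geomTorsion ((p : ℤ) ^ j)))
    (hw : κ.eisensteinTwist (W.torsionGaloisModule ((p : ℤ) ^ j)) hm j σ₀ w = w) :
    (p : ℤ) • w = 0 := by
  have h := κ.natCast_smul_mem_of_eisensteinTwist_apply_sub_mem W hm hpK hσ hms j ⊥
    (fun c x hx ↦ by rw [AddSubgroup.mem_bot] at hx ⊢; rw [hx, smul_zero])
    (fun x hx ↦ by rw [AddSubgroup.mem_bot] at hx ⊢; rw [hx, map_zero]) w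
    (by rw [AddSubgroup.mem_bot, hw, sub_self])
  exact AddSubgroup.mem_bot.1 h

/-! ## §3 Local forms at a finite place: invariants of `W_{m,j}`, of `W_{m,j}` modulo `Fil`, of the quotient, and of `Tw` -/

variable {K : Type} [Field K] [NumberField K] (E : WeierstrassCurve K) [E.IsElliptic] (κ' : ZpExtension K p)
  {m : ℕ} (hm : 1 ≤ m)

/-- **Local form, modulo a stable subgroup.**  At a finite place `w` with some `g₀ ∈ Γ_{K_w}`, `κ(g₀) = p^s`, `2p^s < m`:
for every additive subgroup `N ≤ W_{m,j}` stable under `A_{m,j}` and under `g₀`, every `x` with `g₀ x − x ∈ N` has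
`(p : ℤ) • x ∈ N`. [cite: Howard2004HeegnerKolyvagin, §1.3 H.4, §2.2 and §3.1] [cite: GreenbergLNM1716, proof of Prop. 4.15] -/
theorem natCast_smul_mem_of_toLocal_apply_sub_mem (w : IsDedekindDomain.HeightOneSpectrum (NumberField.RingOfIntegers K))
    {g₀ : absoluteGaloisGroup (w.adicCompletion K)} {s : ℕ}
    (hg₀ : (κ' (absGaloisRestrict K (w.adicCompletion K) g₀)).toAdd = ((p ^ s : ℕ) : ℤ_[p])) (hms : 2 * p ^ s < m)
    (j : ℕ) (N : AddSubgroup (Twisted p m j (E.geomTorsion ((p : ℤ) ^ j))))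
    (hNA : ∀ (c : EisensteinCoeff p m j) (x : Twisted p m j (E.geomTorsion ((p : ℤ) ^ j))), x ∈ N → c • x ∈ N)
    (hNg : ∀ x ∈ N, ((κ'.eisensteinTwist (E.torsionGaloisModule ((p : ℤ) ^ j)) hm j).toLocal (Sum.inr w)) g₀ x ∈ N)
    (x : Twisted p m j (E.geomTorsion ((p : ℤ) ^ j)))
    (hx : ((κ'.eisensteinTwist (E.torsionGaloisModule ((p : ℤ) ^ j)) hm j).toLocal (Sum.inr w)) g₀ x - x ∈ N) :
    (p : ℤ) • x ∈ N :=
  κ'.natCast_smul_mem_of_eisensteinTwist_apply_sub_mem E hm (Nat.cast_ne_zero.2 hp.out.ne_zero) hg₀ hms j N hNA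
    hNg x hx

/-- **`p · H⁰(K_w, W_{m,j}) = 0`** in module form: every `Γ_{K_w}`-invariant vector of `E[p^j] ⊗ A_{m,j}(ψ)` is killed by
`p`, as soon as some `g₀ ∈ Γ_{K_w}` has `κ(g₀) = p^s` with `2p^s < m` (every `j`; in particular for the vectors of the
ordinary sub-twist `Fil_w W_{m,j}`). [cite: Howard2004HeegnerKolyvagin, §1.3 H.4, §2.2 and §3.1]
[cite: GreenbergLNM1716, proof of Prop. 4.15] -/
theorem natCast_smul_eq_zero_of_toLocal_apply_eq_self (w : IsDedekindDomain.HeightOneSpectrum (NumberField.RingOfIntegers K))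
    {g₀ : absoluteGaloisGroup (w.adicCompletion K)} {s : ℕ}
    (hg₀ : (κ' (absGaloisRestrict K (w.adicCompletion K) g₀)).toAdd = ((p ^ s : ℕ) : ℤ_[p])) (hms : 2 * p ^ s < m)
    (j : ℕ) (x : Twisted p m j (E.geomTorsion ((p : ℤ) ^ j)))
    (hx : ((κ'.eisensteinTwist (E.torsionGaloisModule ((p : ℤ) ^ j)) hm j).toLocal (Sum.inr w)) g₀ x = x) :
    (p : ℤ) • x = 0 :=
  κ'.natCast_smul_eq_zero_of_apply_eq_self E hm (Nat.cast_ne_zero.2 hp.out.ne_zero) hg₀ hms j x hx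

variable {M : ℕ → Type} [∀ k, AddCommGroup (M k)] [∀ k, TopologicalSpace (M k)] [∀ k, DiscreteTopology (M k)]

/-- **Invariants modulo the twisted plus part.**  For an ordinary datum `Φ` at `w` on the torsion tower of `E`
(`Fil_w E[p^j]`, e.g. `ordinaryFiltrationAt`) and `g₀ ∈ Γ_{K_w}` with `κ(g₀) = p^s`, `2p^s < m`: every `x ∈ W_{m,j}` with
`g x − x ∈ Fil_w W_{m,j}` for all `g ∈ Γ_{K_w}` has `(p : ℤ) • x ∈ Fil_w W_{m,j}` — `p · H⁰(K_w, W_{m,j}/Fil_w W_{m,j}) = 0`,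
the quotient being Howard's `gr_w` twist (every `j`). [cite: Howard2004HeegnerKolyvagin, §3.1 (Fil_v, gr_v) and Def. 3.2.6]
[cite: GreenbergLNM1716, §2 and proof of Prop. 4.15] -/
theorem OrdinaryFiltration.natCast_smul_mem_twistedFil_of_forall_toLocal_sub_mem
    {w : IsDedekindDomain.HeightOneSpectrum (NumberField.RingOfIntegers K)}
    {t : ∀ k, (E.torsionGaloisModule ((p : ℤ) ^ (k + 1))).toContRepresentation →ⁱL
      (E.torsionGaloisModule ((p : ℤ) ^ k)).toContRepresentation}
    (Φ : OrdinaryFiltration (fun k ↦ E.torsionGaloisModule ((p : ℤ) ^ k)) t w)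
    {g₀ : absoluteGaloisGroup (w.adicCompletion K)} {s : ℕ}
    (hg₀ : (κ' (absGaloisRestrict K (w.adicCompletion K) g₀)).toAdd = ((p ^ s : ℕ) : ℤ_[p])) (hms : 2 * p ^ s < m)
    (j : ℕ) (x : Twisted p m j (E.geomTorsion ((p : ℤ) ^ j)))
    (hx : ∀ g : absoluteGaloisGroup (w.adicCompletion K),
      ((κ'.eisensteinTwist (E.torsionGaloisModule ((p : ℤ) ^ j)) hm j).toLocal (Sum.inr w)) g x - x ∈
        Φ.twistedFil (p := p) (m := m) j) :
    (p : ℤ) • x ∈ Φ.twistedFil (p := p) (m := m) j :=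
  κ'.natCast_smul_mem_of_toLocal_apply_sub_mem E hm w hg₀ hms j (Φ.twistedFil (p := p) (m := m) j).toAddSubgroup
    (fun c _ hy ↦ Φ.smul_mem_twistedFil j c hy) (fun _ hy ↦ Φ.twistedFil_le_comap (κ := κ') hm j g₀ hy) x (hx g₀)

/-- **`p · H⁰(K_w, W_{m,j}/Fil_w W_{m,j}) = 0` on the quotient module** (the tree's `ContinuousRep.quotient` of the local
module by `twistedFil`, whose `H¹` cuts out `ordinaryCore`): every `Γ_{K_w}`-fixed class of the quotient is killed by `p`
(`g₀ ∈ Γ_{K_w}` with `κ(g₀) = p^s`, `2p^s < m`; every `j`). [cite: Howard2004HeegnerKolyvagin, §3.1 (gr_v) and Def. 3.2.6]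
[cite: GreenbergLNM1716, §2 and proof of Prop. 4.15] -/
theorem OrdinaryFiltration.natCast_smul_eq_zero_of_forall_quotient_apply_eq_self
    {w : IsDedekindDomain.HeightOneSpectrum (NumberField.RingOfIntegers K)}
    {t : ∀ k, (E.torsionGaloisModule ((p : ℤ) ^ (k + 1))).toContRepresentation →ⁱL
      (E.torsionGaloisModule ((p : ℤ) ^ k)).toContRepresentation}
    (Φ : OrdinaryFiltration (fun k ↦ E.torsionGaloisModule ((p : ℤ) ^ k)) t w)
    {g₀ : absoluteGaloisGroup (w.adicCompletion K)} {s : ℕ}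
    (hg₀ : (κ' (absGaloisRestrict K (w.adicCompletion K) g₀)).toAdd = ((p ^ s : ℕ) : ℤ_[p])) (hms : 2 * p ^ s < m)
    (j : ℕ) (xbar : Twisted p m j (E.geomTorsion ((p : ℤ) ^ j)) ⧸ Φ.twistedFil (p := p) (m := m) j)
    (hx : ∀ g : absoluteGaloisGroup (w.adicCompletion K),
      (GaloisRep.toLocal w (κ'.eisensteinTwist (E.torsionGaloisModule ((p : ℤ) ^ j)) hm j)).quotient
        (Φ.twistedFil (p := p) (m := m) j) (Φ.twistedFil_le_comap hm j) g xbar = xbar) :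
    (p : ℤ) • xbar = 0 := by
  induction xbar using Submodule.Quotient.induction_on with
  | _ x =>
    have hmem : (p : ℤ) • x ∈ Φ.twistedFil (p := p) (m := m) j :=
      Φ.natCast_smul_mem_twistedFil_of_forall_toLocal_sub_mem E κ' hm hg₀ hms j x fun g ↦ by
        rw [← Submodule.Quotient.eq]
        exact hx g
    have h2 : (Φ.twistedFil (p := p) (m := m) j).mkQ ((p : ℤ) • x) = 0 := (Submodule.Quotient.mk_eq_zero _).2 hmem
    rwa [map_zsmul] at h2

/-- For Howard's conjugation twist `Tw(W_{m,j})` (`g ↦ ρ(τ⁻¹ g τ)`, `ConjugationDatum.twist`) the element to feed is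
`σ₁ = τ⁻¹ g₀⁻¹ τ`: **if `κ` is anticyclotomic for `cd` (`κ(τ⁻¹ g τ) = −κ(g)`) and `κ(g₀) = p^s` for `g₀ ∈ Γ_{K_w}`, then
`κ(τ⁻¹ g₀⁻¹ τ) = p^s`.** [cite: Howard2004HeegnerKolyvagin, §1.3 (arXiv p. 7, L33–41: Tw(T)) and §2.2] -/
theorem toAdd_apply_conj_absGaloisRestrict_inv_eq_of_anticyclotomic
    (cd : Literature.NumberTheory.GaloisCohomology.Howard2004.ConjugationDatum K)
    (hanti : ∀ g : absoluteGaloisGroup K, (κ' (cd.conj g)).toAdd = -(κ' g).toAdd)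
    (w : IsDedekindDomain.HeightOneSpectrum (NumberField.RingOfIntegers K))
    {g₀ : absoluteGaloisGroup (w.adicCompletion K)} {s : ℕ}
    (hg₀ : (κ' (absGaloisRestrict K (w.adicCompletion K) g₀)).toAdd = ((p ^ s : ℕ) : ℤ_[p])) :
    (κ' (cd.conj (absGaloisRestrict K (w.adicCompletion K) g₀⁻¹))).toAdd = ((p ^ s : ℕ) : ℤ_[p]) := by
  rw [map_inv, map_inv, map_inv, toAdd_inv, hanti, neg_neg, hg₀]

/-- **Local form for the conjugation twist `Tw(W_{m,j})` at `w`, modulo a stable subgroup.**  If `g₁ ∈ Γ_{K_w}` has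
`κ(τ⁻¹ g₁ τ) = p^s` (for an anticyclotomic `κ` take `g₁ = g₀⁻¹` with `κ(g₀) = p^s`, previous lemma), `2p^s < m`: for every
additive subgroup `N ≤ W_{m,j}` stable under `A_{m,j}` and under `g₁` acting through `Tw`, every `x` fixed by `g₁` in
`Tw(W_{m,j})|_{Γ_{K_w}}` modulo `N` has `(p : ℤ) • x ∈ N` — `p · H⁰(K_w, Tw(W_{m,j})/N) = 0` (the `Y`-side twists `gr′`,
`Fil′` of H.4). [cite: Howard2004HeegnerKolyvagin, §1.3 H.4 (arXiv p. 7, L33–48, L78–82) and §2.2]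
[cite: GreenbergLNM1716, proof of Prop. 4.15] -/
theorem natCast_smul_mem_of_twist_toLocal_apply_sub_mem
    (cd : Literature.NumberTheory.GaloisCohomology.Howard2004.ConjugationDatum K)
    (w : IsDedekindDomain.HeightOneSpectrum (NumberField.RingOfIntegers K))
    {g₁ : absoluteGaloisGroup (w.adicCompletion K)} {s : ℕ}
    (hσ₁ : (κ' (cd.conj (absGaloisRestrict K (w.adicCompletion K) g₁))).toAdd = ((p ^ s : ℕ) : ℤ_[p]))
    (hms : 2 * p ^ s < m) (j : ℕ) (N : AddSubgroup (Twisted p m j (E.geomTorsion ((p : ℤ) ^ j))))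
    (hNA : ∀ (c : EisensteinCoeff p m j) (x : Twisted p m j (E.geomTorsion ((p : ℤ) ^ j))), x ∈ N → c • x ∈ N)
    (hNg : ∀ x ∈ N, (GaloisRep.toLocal w (cd.twist (κ'.eisensteinTwist (E.torsionGaloisModule ((p : ℤ) ^ j)) hm j)))
      g₁ x ∈ N)
    (x : Twisted p m j (E.geomTorsion ((p : ℤ) ^ j)))
    (hx : (GaloisRep.toLocal w (cd.twist (κ'.eisensteinTwist (E.torsionGaloisModule ((p : ℤ) ^ j)) hm j))) g₁ x - x
      ∈ N) :
    (p : ℤ) • x ∈ N := by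
  rw [GaloisRep.toLocal_apply, Literature.NumberTheory.GaloisCohomology.Howard2004.ConjugationDatum.twist_apply] at hx
  exact κ'.natCast_smul_mem_of_eisensteinTwist_apply_sub_mem E hm (Nat.cast_ne_zero.2 hp.out.ne_zero) hσ₁ hms j N hNA
    (fun y hy ↦ by
      have h := hNg y hy
      rwa [GaloisRep.toLocal_apply, Literature.NumberTheory.GaloisCohomology.Howard2004.ConjugationDatum.twist_apply]
        at h)
    x hx

/-! ## §4 The element `g₀` from `decomp w ⊄ ker κ`, and the packaged uniform statement -/

/-- **At a place whose decomposition group is not inside `ker κ`, some `g₀ ∈ Γ_{K_w}` has `κ(g₀) = p^s` exactly** (the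
image of `Γ_{K_w}` in `ℤ_p` is a non-zero closed subgroup `p^s ℤ_p`).  Above `p` in the anticyclotomic tower the hypothesis
is the tree's `decomp_not_le_kerSubgroup_above_of_isAnticyclotomic_anyPrime`.
[cite: SerreGaloisCohomology1997, Ch. I §1.4 (closed subgroups of ℤ_p)] [cite: Washington1997, §13.1] -/
theorem exists_toAdd_apply_absGaloisRestrict_eq_pow_of_not_decomp_le
    (w : IsDedekindDomain.HeightOneSpectrum (NumberField.RingOfIntegers K))
    (hdec : ¬ (GreenbergSelmer.decomp w ≤ κ'.kerSubgroup)) :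
    ∃ (s : ℕ) (g₀ : absoluteGaloisGroup (w.adicCompletion K)),
      (κ' (absGaloisRestrict K (w.adicCompletion K) g₀)).toAdd = ((p ^ s : ℕ) : ℤ_[p]) := by
  have hne : ∃ h₀ : absoluteGaloisGroup (w.adicCompletion K), κ' (absGaloisRestrict K (w.adicCompletion K) h₀) ≠ 1 := by
    by_contra hall
    push Not at hall
    exact hdec fun δ hδ ↦ by
      obtain ⟨σ, rfl⟩ := (GreenbergSelmer.mem_decomp_iff w δ).1 hδ
      exact ZpExtension.mem_kerSubgroup.2 (hall σ)
  obtain ⟨h₀, hh₀⟩ := hne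
  exact κ'.exists_toAdd_apply_absGaloisRestrict_eq_pow (w.adicCompletion K) h₀ hh₀

/-- **(B4) packaged: uniform `p`-torsion of the local invariants at a finitely decomposed place, for all large `m` and
all levels `j`.**  If `decomp w ⊄ ker κ` then there is `m₀` (`= 2p^{s_w}`) such that for every `m > m₀` and every `j`:
(i) every `Γ_{K_w}`-invariant vector of `W_{m,j} = E[p^j] ⊗ A_{m,j}(ψ)` is killed by `p`; and for every ordinary datum `Φ`
at `w` (ii) every `x` invariant modulo `Fil_w W_{m,j}` has `p • x ∈ Fil_w W_{m,j}` and (iii) every `Γ_{K_w}`-fixed class of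
the quotient module `W_{m,j}/Fil_w W_{m,j}` is killed by `p`.  Exponent `1`, uniform in `j` and `m` — the torsion-exponent
input (d) of the H.4 plan at `w ∣ p`. [cite: Howard2004HeegnerKolyvagin, §1.3 H.4, §2.2, §3.1 and Def. 3.2.6]
[cite: GreenbergLNM1716, §2 and proof of Prop. 4.15] [cite: MilneADT2006, Ch. I Cor. 2.3] -/
theorem exists_forall_natCast_smul_invariants_of_not_decomp_le
    (w : IsDedekindDomain.HeightOneSpectrum (NumberField.RingOfIntegers K))
    (hdec : ¬ (GreenbergSelmer.decomp w ≤ κ'.kerSubgroup))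
    (t : ∀ k, (E.torsionGaloisModule ((p : ℤ) ^ (k + 1))).toContRepresentation →ⁱL
      (E.torsionGaloisModule ((p : ℤ) ^ k)).toContRepresentation) :
    ∃ m₀ : ℕ, ∀ (m : ℕ) (hm : 1 ≤ m), m₀ < m → ∀ j : ℕ,
      (∀ x : Twisted p m j (E.geomTorsion ((p : ℤ) ^ j)),
        (∀ g : absoluteGaloisGroup (w.adicCompletion K),
          ((κ'.eisensteinTwist (E.torsionGaloisModule ((p : ℤ) ^ j)) hm j).toLocal (Sum.inr w)) g x = x) →
        (p : ℤ) • x = 0) ∧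
      ∀ Φ : OrdinaryFiltration (fun k ↦ E.torsionGaloisModule ((p : ℤ) ^ k)) t w,
        (∀ x : Twisted p m j (E.geomTorsion ((p : ℤ) ^ j)),
          (∀ g : absoluteGaloisGroup (w.adicCompletion K),
            ((κ'.eisensteinTwist (E.torsionGaloisModule ((p : ℤ) ^ j)) hm j).toLocal (Sum.inr w)) g x - x ∈
              Φ.twistedFil (p := p) (m := m) j) →
          (p : ℤ) • x ∈ Φ.twistedFil (p := p) (m := m) j) ∧
        (∀ xbar : Twisted p m j (E.geomTorsion ((p : ℤ) ^ j)) ⧸ Φ.twistedFil (p := p) (m := m) j,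
          (∀ g : absoluteGaloisGroup (w.adicCompletion K),
            (GaloisRep.toLocal w (κ'.eisensteinTwist (E.torsionGaloisModule ((p : ℤ) ^ j)) hm j)).quotient
              (Φ.twistedFil (p := p) (m := m) j) (Φ.twistedFil_le_comap hm j) g xbar = xbar) →
          (p : ℤ) • xbar = 0) := by
  obtain ⟨s, g₀, hg₀⟩ := κ'.exists_toAdd_apply_absGaloisRestrict_eq_pow_of_not_decomp_le w hdec
  refine ⟨2 * p ^ s, fun m hm hms j ↦ ⟨fun x hx ↦ ?_, fun Φ ↦ ⟨fun x hx ↦ ?_, fun xbar hx ↦ ?_⟩⟩⟩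
  · exact κ'.natCast_smul_eq_zero_of_toLocal_apply_eq_self E hm w hg₀ hms j x (hx g₀)
  · exact Φ.natCast_smul_mem_twistedFil_of_forall_toLocal_sub_mem E κ' hm hg₀ hms j x hx
  · exact Φ.natCast_smul_eq_zero_of_forall_quotient_apply_eq_self E κ' hm hg₀ hms j xbar hx

end ZpExtension

end Literature.NumberTheory.EllipticCurves

end
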